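import Mathlib
import HarnessLib

/-!
# Layer cake: weak-`L¹` tail bounds give fractional-moment bounds

Stub `stub_layerCake` of line `live-seal-vanishing-sprinkle` for the crux
`PercNearOneGluing.NearOneGluing` (stmt-CriticalPhenomena-4574).  Pure measure theory:
on a probability space, tail bounds `μ(B ∩ {θ ≤ X}) ≤ s/θ` (`θ > 0`) for a `[0,1]`-valued
measurable `X` give `∫_B X^t dμ ≤ s^t/(1-t)` for `0 < t < 1`.
-/

namespace Summit.CriticalPhenomena.PercolationContinuityZ3.Theorems

open MeasureTheory Set

/-- Real-variable core of the layer-cake estimate: if `g ≥ 0` on `ℝ` satisfies `g ≤ 1` and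
`g(u) ≤ s·u^{-1/t}` on `(0,∞)` and vanishes on `(1,∞)`, with `0 < s < 1`, `0 < t < 1`, then
`∫_{(0,∞)} g ≤ s^t/(1-t)` (dominate by `1` on `(0,s^t]` and by `s·u^{-1/t}` on `(s^t,1]`). -/
theorem layerCake4574_integral_Ioi_le {s t : ℝ} (hs0 : 0 < s) (hs1 : s < 1) (ht0 : 0 < t)
    (ht1 : t < 1) (g : ℝ → ℝ) (hg0 : ∀ u, 0 ≤ g u) (hg1 : ∀ u, 0 < u → g u ≤ 1)
    (hgs : ∀ u, 0 < u → g u ≤ s * u ^ (-t⁻¹)) (hgz : ∀ u, 1 < u → g u = 0) :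
    ∫ u in Ioi 0, g u ≤ s ^ t / (1 - t) := by
  set u₀ : ℝ := s ^ t with hu₀
  have hu₀0 : 0 < u₀ := Real.rpow_pos_of_pos hs0 t
  have hu₀1 : u₀ < 1 := Real.rpow_lt_one hs0.le hs1 ht0
  -- the dominating function `h₁ + h₂`
  set h₁ : ℝ → ℝ := (Ioc 0 u₀).indicator fun _ => (1 : ℝ) with hh₁
  set h₂ : ℝ → ℝ := (Ioc u₀ 1).indicator fun u => s * u ^ (-t⁻¹) with hh₂
  have hi₁ : Integrable h₁ volume :=
    (integrable_indicator_iff measurableSet_Ioc).2 (integrableOn_const measure_Ioc_lt_top.ne)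
  have h0mem : (0 : ℝ) ∉ uIcc u₀ 1 := by
    rw [uIcc_of_le hu₀1.le]
    exact fun h => absurd h.1 (not_le.2 hu₀0)
  have hi₂ : Integrable h₂ volume := by
    refine (integrable_indicator_iff measurableSet_Ioc).2 ?_
    refine (intervalIntegrable_iff_integrableOn_Ioc_of_le hu₀1.le).1 ?_
    exact (intervalIntegral.intervalIntegrable_rpow (Or.inr h0mem)).const_mul s
  have hbound : ∀ u ∈ Ioi (0 : ℝ), g u ≤ h₁ u + h₂ u := by
    intro u hu
    rw [mem_Ioi] at hu
    rcases le_or_gt u u₀ with hle | hlt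
    · have e₁ : h₁ u = 1 := by
        rw [hh₁, indicator_of_mem (show u ∈ Ioc 0 u₀ from ⟨hu, hle⟩)]
      have e₂ : h₂ u = 0 := by
        rw [hh₂, indicator_of_notMem]
        exact fun h => absurd h.1 (not_lt.2 hle)
      rw [e₁, e₂, add_zero]
      exact hg1 u hu
    · have e₁ : h₁ u = 0 := by
        rw [hh₁, indicator_of_notMem]
        exact fun h => absurd h.2 (not_le.2 hlt)
      rcases le_or_gt u 1 with hle1 | hlt1
      · have e₂ : h₂ u = s * u ^ (-t⁻¹) := by
          rw [hh₂, indicator_of_mem (show u ∈ Ioc u₀ 1 from ⟨hlt, hle1⟩)]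
        rw [e₁, e₂, zero_add]
        exact hgs u hu
      · have e₂ : h₂ u = 0 := by
          rw [hh₂, indicator_of_notMem]
          exact fun h => absurd h.2 (not_le.2 hlt1)
        rw [e₁, e₂, add_zero, hgz u hlt1]
  have hmono : ∫ u in Ioi 0, g u ≤ ∫ u in Ioi 0, (h₁ u + h₂ u) := by
    refine integral_mono_of_nonneg (Filter.Eventually.of_forall hg0)
      (hi₁.add hi₂).integrableOn ?_
    exact (ae_restrict_iff' measurableSet_Ioi).2 (Filter.Eventually.of_forall hbound)
  have hI₁ : ∫ u in Ioi 0, h₁ u = u₀ := by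
    rw [hh₁, setIntegral_indicator measurableSet_Ioc,
      (show Ioi (0 : ℝ) ∩ Ioc 0 u₀ = Ioc 0 u₀ from inter_eq_right.2 Ioc_subset_Ioi_self),
      setIntegral_const, Real.volume_real_Ioc_of_le hu₀0.le, smul_eq_mul, mul_one, sub_zero]
  have hsub : Ioc u₀ 1 ⊆ Ioi (0 : ℝ) := fun u hu => hu₀0.trans hu.1
  have ht1' : -t⁻¹ ≠ -1 := by
    intro h
    have : t⁻¹ = 1 := by linarith
    rw [inv_eq_one] at this
    exact absurd this (ne_of_lt ht1)
  have hI₂ : ∫ u in Ioi 0, h₂ u = s * ((1 - u₀ ^ (-t⁻¹ + 1)) / (-t⁻¹ + 1)) := by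
    rw [hh₂, setIntegral_indicator measurableSet_Ioc,
      (show Ioi (0 : ℝ) ∩ Ioc u₀ 1 = Ioc u₀ 1 from inter_eq_right.2 hsub),
      integral_const_mul, ← intervalIntegral.integral_of_le hu₀1.le,
      integral_rpow (Or.inr ⟨ht1', h0mem⟩), Real.one_rpow]
  -- algebra: `s · u₀^{1-1/t} = s^t`
  have hkey : s * u₀ ^ (-t⁻¹ + 1) = s ^ t := by
    rw [hu₀, ← Real.rpow_mul hs0.le]
    have e : t * (-t⁻¹ + 1) = t - 1 := by field_simp; ring
    rw [e, Real.rpow_sub hs0, Real.rpow_one]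
    field_simp
  have hval : u₀ + s * ((1 - u₀ ^ (-t⁻¹ + 1)) / (-t⁻¹ + 1)) = (s ^ t - t * s) / (1 - t) := by
    have e1 : s * ((1 - u₀ ^ (-t⁻¹ + 1)) / (-t⁻¹ + 1)) = (s - s ^ t) / (-t⁻¹ + 1) := by
      rw [← hkey]; ring
    rw [e1, hu₀]
    have ht0' : t ≠ 0 := ht0.ne'
    have ht1'' : (1 - t) ≠ 0 := by linarith
    have e2 : (-t⁻¹ + 1) = -(1 - t) / t := by field_simp; ring
    rw [e2]
    field_simp
    ring
  calc ∫ u in Ioi 0, g u ≤ ∫ u in Ioi 0, (h₁ u + h₂ u) := hmono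
    _ = u₀ + s * ((1 - u₀ ^ (-t⁻¹ + 1)) / (-t⁻¹ + 1)) := by
        rw [integral_add hi₁.integrableOn hi₂.integrableOn, hI₁, hI₂]
    _ = (s ^ t - t * s) / (1 - t) := hval
    _ ≤ s ^ t / (1 - t) :=
        div_le_div_of_nonneg_right (by nlinarith) (by linarith)

/-- **Layer cake (stub 4 of line `live-seal-vanishing-sprinkle`).** On a probability space, if
`0 ≤ X ≤ 1` is measurable and `μ(B ∩ {θ ≤ X}) ≤ s/θ` for every `θ > 0` (`s ≥ 0`), then for
`0 < t < 1`: `∫_B X^t dμ ≤ s^t/(1-t)`.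
Proof: trivial when `s ≥ 1` (the integrand is `≤ 1`); otherwise the layer-cake formula
`∫_B X^t = ∫₀^∞ μ(B ∩ {u < X^t}) du`, the inclusion `{u < X^t} ⊆ {u^{1/t} ≤ X}` and the tail
bounds give `∫_B X^t ≤ ∫₀¹ min(1, s·u^{-1/t}) du = s^t + (t/(1-t))(s^t - s) ≤ s^t/(1-t)`. -/
theorem stub_layerCake {Ω : Type*} [MeasurableSpace Ω] (μ : Measure Ω) [IsProbabilityMeasure μ]
    (B : Set Ω) (hB : MeasurableSet B) (X : Ω → ℝ) (hX : Measurable X)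
    (h0 : ∀ x, 0 ≤ X x) (h1 : ∀ x, X x ≤ 1) (s t : ℝ) (hs : 0 ≤ s) (ht0 : 0 < t) (ht1 : t < 1)
    (htail : ∀ θ : ℝ, 0 < θ → μ.real (B ∩ {x | θ ≤ X x}) ≤ s / θ) :
    ∫ x, B.indicator (fun x => X x ^ t) x ∂μ ≤ s ^ t / (1 - t) := by
  set f : Ω → ℝ := B.indicator (fun x => X x ^ t) with hf
  have hf0 : ∀ x, 0 ≤ f x := fun x =>
    Set.indicator_nonneg (fun y _ => Real.rpow_nonneg (h0 y) t) x
  have hf1 : ∀ x, f x ≤ 1 := fun x =>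
    Set.indicator_le' (fun y _ => Real.rpow_le_one (h0 y) (h1 y) ht0.le)
      (fun _ _ => zero_le_one) x
  have hfm : Measurable f := (hX.pow_const t).indicator hB
  have hfi : Integrable f μ :=
    Integrable.mono' (integrable_const (1 : ℝ)) hfm.aestronglyMeasurable
      (Filter.Eventually.of_forall fun x => by
        rw [Real.norm_eq_abs, abs_of_nonneg (hf0 x)]; exact hf1 x)
  rcases le_or_gt 1 s with hs1 | hs1
  · -- `s ≥ 1`: the integrand is at most `1 ≤ s^t ≤ s^t/(1-t)`
    have hst : 1 ≤ s ^ t := Real.one_le_rpow hs1 ht0.le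
    calc ∫ x, f x ∂μ ≤ ∫ _, (1 : ℝ) ∂μ := integral_mono hfi (integrable_const 1) hf1
      _ = 1 := by simp
      _ ≤ s ^ t / (1 - t) := by
          rw [le_div_iff₀ (by linarith)]
          nlinarith
  -- layer cake
  have hlc : ∫ x, f x ∂μ = ∫ u in Ioi 0, μ.real {x | u < f x} :=
    hfi.integral_eq_integral_meas_lt (Filter.Eventually.of_forall hf0)
  set g : ℝ → ℝ := fun u => μ.real {x | u < f x} with hg
  have hg0 : ∀ u, 0 ≤ g u := fun u => measureReal_nonneg
  have hg1 : ∀ u, 0 < u → g u ≤ 1 := fun u _ => measureReal_le_one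
  have hgz : ∀ u, 1 < u → g u = 0 := by
    intro u hu
    have he : {x | u < f x} = ∅ := by
      ext x
      simp only [mem_setOf_eq, mem_empty_iff_false, iff_false, not_lt]
      exact (hf1 x).trans hu.le
    simp only [hg, he, measureReal_empty]
  have hgs : ∀ u, 0 < u → g u ≤ s * u ^ (-t⁻¹) := by
    intro u hu
    have hsub : {x | u < f x} ⊆ B ∩ {x | u ^ t⁻¹ ≤ X x} := by
      intro x hx
      rw [mem_setOf_eq] at hx
      have hxB : x ∈ B := by
        by_contra hxB
        rw [hf, indicator_of_notMem hxB] at hx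
        exact absurd hx (not_lt.2 hu.le)
      refine ⟨hxB, ?_⟩
      rw [hf, indicator_of_mem hxB] at hx
      exact ((Real.rpow_inv_lt_iff_of_pos hu.le (h0 x) ht0).2 hx).le
    calc g u ≤ μ.real (B ∩ {x | u ^ t⁻¹ ≤ X x}) := measureReal_mono hsub
      _ ≤ s / u ^ t⁻¹ := htail _ (Real.rpow_pos_of_pos hu _)
      _ = s * u ^ (-t⁻¹) := by rw [Real.rpow_neg hu.le, div_eq_mul_inv]
  rw [hlc]
  rcases hs.eq_or_lt with hs0 | hs0
  · -- `s = 0`: `g` vanishes on `(0, ∞)`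
    subst hs0
    have hle : ∫ u in Ioi 0, g u ≤ ∫ _ in Ioi (0 : ℝ), (0 : ℝ) := by
      refine integral_mono_of_nonneg (Filter.Eventually.of_forall hg0) (integrable_zero _ _ _) ?_
      refine (ae_restrict_iff' measurableSet_Ioi).2 (Filter.Eventually.of_forall fun u hu => ?_)
      simpa using hgs u hu
    rw [Real.zero_rpow ht0.ne', zero_div]
    simpa using hle
  · exact layerCake4574_integral_Ioi_le hs0 hs1 ht0 ht1 g hg0 hg1 hgs hgz

end Summit.CriticalPhenomena.PercolationContinuityZ3.Theorems
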